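import Literature.Barriers.CriticalPhenomena.ParafermionicHalfCauchyRiemann
import Literature.Probability.LatticeModels.TriangularLatticeProofs
import HarnessLib

/-!
# Pick engine, STAGE 1 (S2) helper: the weighted star-regrouping identity

Support file for crux `BoundaryClosureR` (stmt-CriticalPhenomena-14004), line `pick-half-plane`,
stub `stub_pickEngine`, stage 1, step (S2) (weak `∂̄`-closure of the limit of the normalised
functionals).  The mechanism is summation by parts on the honeycomb lattice: sum the vertex
relation (DCS Lemma 1) at every `v ∈ Λ` against a weight `φ v` and regroup by edges.  This file
delivers the EXACT REGROUPING IDENTITY, for every finite vertex set `S`, every function `F` on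
mid-edges and every weight `φ : HexVertex → ℂ` (no relation assumed):

  `Σ_{v ∈ S} φ v · Σ_{w ∼ v} (mid{v,w} - c_v) F{v,w}`
    `= Σ_{v ∈ S, v up} Σ_{w ∼ v, w ∈ S} (φ v - φ w) · (mid{v,w} - c_v) F{v,w}`      (interior edges,
       oriented from the UP face `v.2 = 0` to the DOWN face — every edge of `ℍ` has exactly one
       up endpoint — as in the route's `ConjugateClassNegligible`)
    `+ Σ_{v ∈ S} Σ_{w ∼ v, w ∉ S} φ v · (mid{v,w} - c_v) F{v,w}`                    (boundary darts)

(`pickEngine_starRegrouping`), the weighted version of the barrier file's discrete Green identity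
`HexGreen.sum_relations_eq_hexFlux` (`φ ≡ 1`): the two contributions of an interior edge carry
the weights of its two endpoints and the opposite coefficients `±(mid - c)`
(`HexKernel.term_add_term_swap`).  With `SatisfiesVertexRelations S F` the left side vanishes
(`starRegrouping_of_satisfiesVertexRelations`): the interior sum equals minus the boundary-dart
sum — the summation-by-parts identity behind `Σ_e F(e)[(c_w-c_v)²∂φ + |c_w-c_v|²∂̄φ](δ·mid e)
= O(δ · mass)`.  References: Duminil-Copin–Smirnov, Ann. of Math. 175 (2012), §3 (proof of
Lemma 2: "sum the relation over all vertices; values at interior mid-edges disappear").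
-/

noncomputable section

open scoped BigOperators
open Finset
open Literature.Probability.LatticeModels Literature.Probability.RandomPlanarGeometry
open Literature.Probability.RandomPlanarGeometry.SAW
open Literature.Barriers.CriticalPhenomena Literature.Barriers.CriticalPhenomena.HexKernel
open Literature.Barriers.CriticalPhenomena.HexGreen

namespace Summit.CriticalPhenomena.SAWScalingLimit.Theorems.PickHalfPlane.Engine

/-- Bipartiteness through `nbrs`: a neighbour of an up face is a down face. [folklore] -/
theorem snd_eq_one_of_mem_nbrs {v w : HexVertex} (hv : v.2 = 0) (hw : w ∈ nbrs v) : w.2 = 1 := by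
  obtain ⟨y, i⟩ := v
  simp only at hv
  subst hv
  rw [nbrs_up] at hw
  simp only [mem_insert, mem_singleton] at hw
  rcases hw with rfl | rfl | rfl <;> rfl

/-- Bipartiteness through `nbrs`: a neighbour of a down face is an up face. [folklore] -/
theorem snd_eq_zero_of_mem_nbrs {v w : HexVertex} (hv : v.2 = 1) (hw : w ∈ nbrs v) : w.2 = 0 := by
  obtain ⟨y, i⟩ := v
  simp only at hv
  subst hv
  rw [nbrs_down] at hw
  simp only [mem_insert, mem_singleton] at hw
  rcases hw with rfl | rfl | rfl <;> rfl

/-- The second coordinate of a hexagonal vertex is `0` (up face) or `1` (down face). [folklore] -/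
theorem snd_eq_zero_or_one (v : HexVertex) : v.2 = 0 ∨ v.2 = 1 := by
  obtain ⟨y, i⟩ := v
  fin_cases i
  · exact Or.inl rfl
  · exact Or.inr rfl

/-- **The down-to-up half of the interior sum, re-indexed by the up endpoint.** For any
`f : HexVertex → HexVertex → ℂ`, summing `f v w` over down faces `v ∈ S` and their neighbours
`w ∈ S` is summing `f v w` over up faces `w ∈ S` and their neighbours `v ∈ S` (every such
ordered pair is a down–up edge; adjacency is symmetric, `HexGreen.mem_nbrs_comm`). [folklore] -/
theorem sum_down_nbrs_eq_sum_up_nbrs (S : Finset HexVertex) (f : HexVertex → HexVertex → ℂ) :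
    ∑ v ∈ S.filter (fun v => v.2 = 1), ∑ w ∈ (nbrs v).filter (· ∈ S), f v w =
      ∑ w ∈ S.filter (fun w => w.2 = 0), ∑ v ∈ (nbrs w).filter (· ∈ S), f v w := by
  classical
  -- both sides as sums over `S × S` of an indicator
  have hL : ∑ v ∈ S.filter (fun v => v.2 = 1), ∑ w ∈ (nbrs v).filter (· ∈ S), f v w =
      ∑ v ∈ S, ∑ w ∈ S, if v.2 = 1 ∧ w ∈ nbrs v then f v w else 0 := by
    rw [sum_filter]
    refine sum_congr rfl fun v _ => ?_
    by_cases hv : v.2 = 1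
    · rw [if_pos hv, Finset.filter_mem_eq_inter, Finset.inter_comm, ← Finset.filter_mem_eq_inter,
        sum_filter]
      refine sum_congr rfl fun w _ => ?_
      by_cases hw : w ∈ nbrs v
      · rw [if_pos hw, if_pos ⟨hv, hw⟩]
      · rw [if_neg hw, if_neg (fun h => hw h.2)]
    · rw [if_neg hv]
      refine (sum_eq_zero fun w _ => ?_).symm
      rw [if_neg (fun h => hv h.1)]
  have hR : ∑ w ∈ S.filter (fun w => w.2 = 0), ∑ v ∈ (nbrs w).filter (· ∈ S), f v w =
      ∑ w ∈ S, ∑ v ∈ S, if w.2 = 0 ∧ v ∈ nbrs w then f v w else 0 := by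
    rw [sum_filter]
    refine sum_congr rfl fun w _ => ?_
    by_cases hw : w.2 = 0
    · rw [if_pos hw, Finset.filter_mem_eq_inter, Finset.inter_comm, ← Finset.filter_mem_eq_inter,
        sum_filter]
      refine sum_congr rfl fun v _ => ?_
      by_cases hv : v ∈ nbrs w
      · rw [if_pos hv, if_pos ⟨hw, hv⟩]
      · rw [if_neg hv, if_neg (fun h => hv h.2)]
    · rw [if_neg hw]
      refine (sum_eq_zero fun v _ => ?_).symm
      rw [if_neg (fun h => hw h.1)]
  rw [hL, hR, sum_comm]
  refine sum_congr rfl fun w _ => sum_congr rfl fun v _ => ?_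
  -- the two indicators agree: `v` down with `w ∼ v` iff `w` up with `v ∼ w`
  by_cases h : v.2 = 1 ∧ w ∈ nbrs v
  · have hw0 : w.2 = 0 := snd_eq_zero_of_mem_nbrs h.1 h.2
    have hvw : v ∈ nbrs w := (mem_nbrs_comm v w).1 h.2
    rw [if_pos h, if_pos ⟨hw0, hvw⟩]
  · have h' : ¬ (w.2 = 0 ∧ v ∈ nbrs w) := by
      rintro ⟨hw0, hvw⟩
      exact h ⟨snd_eq_one_of_mem_nbrs hw0 hvw, (mem_nbrs_comm w v).1 hvw⟩
    rw [if_neg h, if_neg h']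

/-- **The weighted star-regrouping identity (registered sub-goal `pickEngine_starRegrouping` of
stub `stub_pickEngine`).** For every finite vertex set `S`, every function `F` on mid-edges and
every weight `φ`, the weighted sum of the vertex-relation left sides regroups into the sum over
the interior edges, oriented from the up face to the down face, of `(φ v - φ w)(mid - c_v)F`,
plus the weighted boundary-dart sum (Duminil-Copin–Smirnov 2012, §3, weighted). [folklore] -/
theorem pickEngine_starRegrouping :
    ∀ (S : Finset HexVertex) (F : Sym2 HexVertex → ℂ) (φ : HexVertex → ℂ),
      ∑ v ∈ S, φ v * ∑ w ∈ nbrs v, term F v w =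
        ∑ v ∈ S.filter (fun v => v.2 = 0), ∑ w ∈ (nbrs v).filter (· ∈ S),
            (φ v - φ w) * term F v w +
          ∑ v ∈ S, ∑ w ∈ (nbrs v).filter (· ∉ S), φ v * term F v w := by
  intro S F φ
  classical
  -- split every star into its interior and boundary darts
  have hsplit : ∀ v, φ v * ∑ w ∈ nbrs v, term F v w =
      ∑ w ∈ (nbrs v).filter (· ∈ S), φ v * term F v w +
        ∑ w ∈ (nbrs v).filter (· ∉ S), φ v * term F v w := by
    intro v
    rw [mul_sum, ← sum_filter_add_sum_filter_not (nbrs v) (· ∈ S)]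
  rw [sum_congr rfl fun v _ => hsplit v, sum_add_distrib]
  congr 1
  -- the interior darts: split the tail `v` by parity and re-index the down ones
  have hpar : ∑ v ∈ S, ∑ w ∈ (nbrs v).filter (· ∈ S), φ v * term F v w =
      ∑ v ∈ S.filter (fun v => v.2 = 0), ∑ w ∈ (nbrs v).filter (· ∈ S), φ v * term F v w +
        ∑ v ∈ S.filter (fun v => v.2 = 1), ∑ w ∈ (nbrs v).filter (· ∈ S), φ v * term F v w := by
    rw [← sum_filter_add_sum_filter_not S (fun v => v.2 = 0)]
    congr 1
    refine sum_congr ?_ fun _ _ => rfl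
    ext v
    simp only [mem_filter, and_congr_right_iff]
    intro _
    rcases snd_eq_zero_or_one v with h | h <;> simp [h]
  rw [hpar, sum_down_nbrs_eq_sum_up_nbrs S (fun v w => φ v * term F v w), ← sum_add_distrib]
  refine sum_congr rfl fun v _ => ?_
  rw [← sum_add_distrib]
  refine sum_congr rfl fun w _ => ?_
  have hanti : term F w v = -term F v w := eq_neg_of_add_eq_zero_right (term_add_term_swap F v w)
  rw [hanti]
  ring

/-- **Summation by parts against the vertex relations.** If `F` satisfies the vertex relations
of Duminil-Copin–Smirnov at every vertex of `S` (`SatisfiesVertexRelations S F`, e.g. the critical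
observable by DCS Lemma 1), then for every weight `φ` the up-oriented interior edge sum of
`(φ v - φ w)(mid - c_v)F` equals minus the weighted boundary-dart sum. [folklore] -/
theorem starRegrouping_of_satisfiesVertexRelations {S : Finset HexVertex}
    {F : Sym2 HexVertex → ℂ} (hF : SatisfiesVertexRelations S F) (φ : HexVertex → ℂ) :
    ∑ v ∈ S.filter (fun v => v.2 = 0), ∑ w ∈ (nbrs v).filter (· ∈ S),
        (φ v - φ w) * term F v w =
      -∑ v ∈ S, ∑ w ∈ (nbrs v).filter (· ∉ S), φ v * term F v w := by
  have h0 : ∑ v ∈ S, φ v * ∑ w ∈ nbrs v, term F v w = 0 := by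
    refine sum_eq_zero fun v hv => ?_
    rw [(satisfiesVertexRelations_iff_sum S F).1 hF v hv, mul_zero]
  rw [pickEngine_starRegrouping S F φ] at h0
  linear_combination h0

end Summit.CriticalPhenomena.SAWScalingLimit.Theorems.PickHalfPlane.Engine

end
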